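import Literature.MathematicalPhysics.QuantumFieldTheory.BalabanImbrieJaffe1984to88.BIJ88BlockGauge417
import Literature.MathematicalPhysics.QuantumFieldTheory.BalabanImbrieJaffe1984to88.BIJ88InductiveForm41
import Literature.MathematicalPhysics.QuantumFieldTheory.BalabanImbrieJaffe1984to88.BIJ88FreeCount48
import Literature.MathematicalPhysics.QuantumFieldTheory.BalabanImbrieJaffe1984to88.BIJ88Sect5Statements

/-!
# `BalabanImbrieJaffe1984to88.BIJ88RT51GeneralStep` — T. Bałaban, J. Imbrie, A. Jaffe, *Effective action and cluster properties of
the abelian Higgs model*, Commun. Math. Phys. **114** (1988) 257–315 [BalabanImbrieJaffe1988], Sect. 5.1 *Renormalization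
Transformation*, pp. 277–278: the renormalization transformation **(5.1.1)** OF THE GENERAL STEP (the `ψ`-constraint integrated
against the BACKGROUND field, `Q(u_k)φ`, and the earlier fluctuation fields `u^{(j)}` integrated before `φ`) TYPED; the
normalizations **(5.1.2)**/**(5.1.3)** PROVED; and **(5.1.4)** *"no change is made if we insert the axial gauge conditions"* PROVED —
the lattice Faddeev–Popov identity with unit Jacobian for integrands that are invariant ONLY under the gauge transformations which
are trivial at the points of the block lattice `T_L^{(k+1)}`.

statement-level skeleton of published theorems with citation tags; proofs where landed; nothing here is a claim about the Yang–Mills mass gap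

PDF held: `paper:balaban1988-cmp114-bij-abelian-higgs-effective-action` (journal page = PDF page + 256); pp. 277–278 [PDF 21–22]
read as images (r16's CCITT-G4 renders `HOME/lit-balaban-r16/renders/cmp114/original-p021-x2.png`, `original-p022-x2.png`).

CITATION HEADER (lean-in-tree rule).  Part of the lit-balaban TYPED SKELETON (HOME `run/shared/lean/pub/lit-balaban/`), PHASE-2
proof seat p34 gen 5 (unit `lit-balaban-p34-g5`; TAKING line HOME/STATUS.md 2026-08-21T06:18Z, free-target protocol G.5-34(d),
own lineage = the C1/C2 renormalization-transformation line of seat p34: `BIJ88Sect3Rescaling` (3.6)/(3.7), `BIJ85RT33` (3.3),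
`BIJ85RT37Normalization` (3.7), `BIJ88RT311Exists` (3.11)-existence, `BIJ88GaugeAverage`/`BIJ88RTIterated` (3.11) iterated).
Row served: **`C2.Eq5.1.1-5.1.4`** of `HOME/lit-balaban-r16/ROWS-C2-part2.md` (fold owner r16 = C2 Sect. 5; before this file:
*"typed p239854 ((5.1.2) def); rest of block absent"*).

THE PRINTED TEXT (p. 277 [PDF 21] – p. 278 [PDF 22], verbatim).  *"5.1. Renormalization Transformation.  A density of
ρ̃^L_{k+1}(v, ψ) is obtained by applying the renormalization transformations of [1] to ρ′_k as follows:
ρ̃^L_{k+1}(v, ψ) = Σ_{{X_ω}} T_L[∫ Π_{j=0}^{k−1} du^{(j)}_{Λ^{(j)c*}_{10}} T_{a,L,u_k} ρ′_k(u, φ, {X_ω}, {u^{(j)}})]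
≡ Σ_{{X_ω}} ∫𝒟u δ(v/Qu) ∫ Π_{j=0}^{k−1} 𝒟u^{(j)}_{Λ^{(j)c*}_{10}} ∫𝒟φ
× exp[−½aL⁻²⟨ψ − Q(u_k)φ, ψ − Q(u_k)φ⟩ − E^{(k)}] ρ′_k(u, φ, {X_ω}, {u^{(j)}}). (5.1.1)
Here a ≈ 1 is fixed throughout, and the normalization is E^{(k)} = −log(aL^{d−2}/2π). (5.1.2)  We normalize the δ-function on U(1)
so that ∫duδ(u)f(u) = f(1), ∫du = 1. (5.1.3)  Under gauge transformations λ of u, φ, u^{(j)} that vanish on points of T_L^{(k+1)},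
we see that the δ-functions and ρ′_k are invariant. Since u_k also transforms by λ, we have Q(u_k)φ invariant as well. Thus no change
is made if we insert the axial gauge conditions δ_{Ax}(u) = Π_{y∈T₁^{(k)′}} Π_{x∈B(y),x≠y} δ(u(Γ_{y,x})) (5.1.4) into the u-integral
above."*

CARRIERS (all of record; nothing re-declared).  Levels of `Balaban1983to89.Setup` as in r18's typing of (4.1)
(`BIJ88InductiveForm41`): the unit lattice `T₁^{(k)}` of the fields `u : GaugeField P k U1`, `φ : HiggsField P k` is level `k`, the
block lattice `T_L^{(k+1)}` of `v`, `ψ` is level `k + 1` (standing range `k + 1 ≤ m + K`), the earlier fluctuation fields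
`{u^{(j)}}_{j<k}` are `BIJ88InductiveForm41.Prev P k` with the product of normalized Haar measures `prevMeasure` (p. 274 *"∫du^{(j)} =
1"*; as there, integrating over all bonds of level `j` instead of those of `Λ^{(j)c*}_{10}` changes nothing for an integrand ignoring
the others); `𝒟u` = `fieldMeasure` (product Haar probability measure), `𝒟φ`, `dψ` = Lebesgue measure on `ℂ^{T}`; `δ_{Ax}`, its
measure `∫𝒟u δ_{Ax}(u)(·)` = `axialMeasure` (push-forward of `𝒟u` under freezing the block trees `axialBonds`), the normalized
`ψ`-Gaussian `gaussWeight a` ((3.11)–(3.12)) and the typed first-step transformation `IsRT311` are r18's `BIJ88RenormTransf311`; the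
points of `T_L^{(k+1)}` inside `T₁^{(k)}` are the block corners `BIJ85BlockAveragesTorus.corner y` ([2] (2.4) *"y = Ln denotes a
corner of a block"*).

WHAT IS TYPED / PROVED, and how.
* §1 **(5.1.3) PROVED** (the tree's Haar data are normalized by definition): `haar_univ` (`∫du = 1`), `integral_dirac_one`
  (`∫duδ(u)f(u) = f(1)`, `δ` = the unit point mass at `1`), and the product reading of the inserted (5.1.4):
  **`axialMeasure_eq_pi`** — `∫𝒟u δ_{Ax}(u)(·) = ⊗_{b∈trees} δ(u_b) ⊗ ⊗_{b∉trees} du_b`, every factor a probability measure.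
* §2 **(5.1.4), the mechanism, PROVED for every gauge group**: `IsPointed g` (*"gauge transformations … that vanish on points of
  T_L^{(k+1)}"*: `g(corner y) = 1` for every block-lattice point `y`), `PointedInvariant K` (invariance of a function of `u` under
  them).  The cell's measure-level tree gauge fixing `T4AxialGaugeFixing.lintegral_eq_lintegral_fixBonds_of_treeOrder` uses invariance
  of the integrand ONLY under the one-site transformations at the FRESH ends of the tree bonds; for r18's forest
  `treeOrder_axialBonds` the fresh end of a tree bond `b` is `b₊`, which is never a block corner (r18's `BIJ88FreeCount48.tgt_ne_corner`: its
  in-block position in the direction of `b` is positive, `inBlock_tgt`, the corner's is `0`, `inBlock_corner`), and a one-site transformation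
  at a non-corner is pointed (`isPointed_siteTransf`).  Hence the law form `map_eq_map_fixBonds_of_treeOrder` (fresh-end invariance
  only) and **`integral_axialMeasure_eq_of_pointed`**: `∫𝒟u δ_{Ax}(u) K(u) = ∫𝒟u K(u)` for every measurable `K` (values in any
  Banach space) that is invariant under the POINTED gauge transformations — r18's `integral_axialMeasure_eq` asked invariance under
  all of them; `map_axialMeasure_eq_of_pointed` is the law form.
* §3 **(5.1.1) TYPED** in the push-forward reading of the `δ`-functions (the tree's convention, as r18's `IsRT311` for (3.11)):
  `IsRT511 terms Qu Qφ a ρ′ ρ̃` says that for every bounded measurable test function `g(v, ψ)`,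
  `∫dv∫dψ ρ̃(v, ψ)g(v, ψ) = Σ_{t∈terms} ∫𝒟u ∫Π_j𝒟u^{(j)} ∫𝒟φ ∫dψ ρ′_t({u^{(j)}}, u, φ) exp[−½aL⁻²⟨ψ − Q_t φ, ψ − Q_t φ⟩ − |T_L^{(k+1)}|E^{(k)}] g(Qu, ψ)`
  with, as DATA: the finite family `terms` of large-field configurations `{X_ω}` with their densities `ρ′_t = ρ′_k(·, ·, {X_ω}, ·)`
  (r18's `BIJ88InductiveForm41.rhoPrime` of a `Term41` is the (4.1) instance), the gauge-field block average `Qu` ([2] (2.10)), and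
  the background-field scalar average `Q_t = Q(u_k)φ` as a function of `({u^{(j)}}, u, φ)` (the background `u_k` of (4.2) depends on
  `u` and on the `u^{(j)}`, p. 274); READING NOTE on (5.1.2): the constant of the `ψ`-Gaussian is r18's normalized one,
  `E0step |T_L^{(k+1)}| a L d = |T_L^{(k+1)}|·E^{(k)}` (r16's `BIJ88Sect5Statements.E0step_eq_card_mul_normE`, restated here as
  `E0step_level_eq_normE`) — (5.1.2) prints the per-site value, (3.12) the total; with it the `ψ`-integral is `1`
  (`integral_gaussWeight`).  `IsRT511Ax` is (5.1.1) WITH the axial gauge conditions (5.1.4) inserted into the `u`-integral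
  (`axialMeasure`); `uIntegrand` = *"the u-integral above"*'s integrand of one term (`isRT511_iff`, `isRT511Ax_iff`).  PROVED:
  `isRT511Ax_single_iff_isRT311` — one term whose data ignore the earlier fields is EXACTLY r18's (3.11) (`∫Π𝒟u^{(j)} = 1`);
  **`integral_eq_of_isRT511`** — the normalization `∫dv dψ ρ̃^L_{k+1} = Σ_t ∫𝒟u ∫Π𝒟u^{(j)} ∫𝒟φ ρ′_t` of the printed, `δ_{Ax}`-free
  (5.1.1) for ANY data (`a > 0`, `d ≥ 2`: test `g ≡ 1`, Gaussian normalization; no gauge invariance needed without a gauge condition).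
* FILE 2/2 `BIJ88RT51NoChange` (same seat) applies §2 to `uIntegrand`: `IsRT511 ↔ IsRT511Ax` under the printed invariances of `Qu`,
  `ρ′_t`, `Q(u_k)φ` (*"no change is made"*), with the instance of the PRINTED block averages of [2].
NOT DONE HERE (honest scope).  The existence of a density `ρ̃` satisfying (5.1.1) (a Radon–Nikodym derivative; for one term with data
ignoring the earlier fields it is p34 gen 2's `BIJ88RT311Exists.isRT311_rt`); the operators `T_L`, `T_{a,L,u_k}` of [1] as separate
objects (only their displayed composite (5.1.1) is typed); the construction of `u_k`, `{X_ω}`, `ρ′_k` (Sect. 4–5 data, r18/r16); any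
bound.  Re-declares nothing; imports Literature + Mathlib only; no `Prop`-valued fact is introduced (the two `def … : Prop` are the TYPED
display (5.1.1) with and without (5.1.4), definitions in the sense of r18's `IsRT311`); standard axioms.
-/

namespace Literature.MathematicalPhysics.QuantumFieldTheory.BalabanImbrieJaffe1984to88.BIJ88RT51GeneralStep

open Literature.MathematicalPhysics.QuantumFieldTheory.Balaban1983to89
open BIJ88Sect3Statements (U1 toC toC_one E0step)
open BIJ85Sect1Model (HiggsField)
open BIJ85RT33 (JointInvariant twist twist_apply)
open BIJ88RenormTransf311 (inBlock IsAxialBond axialBonds mem_axialBonds inBlock_tgt treeOrder_axialBonds axialMeasure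
  integral_axialMeasure gaussWeight integral_gaussWeight IsRT311)
open BIJ85BlockAveragesTorus (corner inBlock_corner qU qCov qU_gaugeAct qCov_gaugeAct_twist)
open BIJ88InductiveForm41 (Prev prevMeasure)
open BIJ88BlockGauge417 (integral_comp_gaugeAct integral_comp_twist)
open T4AxialGaugeFixing (TreeOrder siteTransf gaugeAct_siteTransf_apply gaugeAct_const_one fixBonds measurable_fixBonds
  fixBonds_apply_of_mem fixBonds_apply_of_not_mem lintegral_eq_lintegral_fixBonds_of_treeOrder)
open GaugeField (gaugeAct GaugeInvariant)
open scoped BigOperators ENNReal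
open _root_.MeasureTheory _root_.MeasureTheory.Measure Complex Function

noncomputable section

variable {P : Params} {j : ℕ}

/-! ## §1 (5.1.3): the normalizations of `du` and of the `δ`-function on `U(1)` -/

section Normalization

variable {G : Type*} [GaugeGroup G] [MeasurableSpace G] [HaarData G]

/-- **(5.1.3), second clause** *"∫du = 1"*: the measure `du` of the renormalization transformations is the NORMALIZED Haar measure on
`U(1)` — in the tree every `HaarData` is a probability measure (and so is the product `𝒟u` over the bonds,
`AveragingRT.fieldMeasure_isProb`). [cite: BalabanImbrieJaffe1988, (5.1.3) p.277] -/
theorem haar_univ : (HaarData.haar : Measure G) Set.univ = 1 := by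
  haveI := HaarData.isProb (G := G)
  exact measure_univ

/-- **(5.1.3), second clause** as an integral: `∫du 1 = 1`. [cite: BalabanImbrieJaffe1988, (5.1.3) p.277] -/
theorem integral_haar_one : ∫ _u : G, (1 : ℝ) ∂(HaarData.haar : Measure G) = 1 := by
  haveI := HaarData.isProb (G := G)
  rw [integral_const, probReal_univ, one_smul]

omit [HaarData G] in
/-- **(5.1.3), first clause** *"We normalize the δ-function on U(1) so that ∫duδ(u)f(u) = f(1)"*: the `δ`-function, as a measure
`δ(u)du`, is the unit point mass at `1 ∈ U(1)`; its integral against any `f` is `f(1)`. [cite: BalabanImbrieJaffe1988, (5.1.3) p.277] -/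
theorem integral_dirac_one [MeasurableSingletonClass G] (f : G → ℂ) : ∫ u, f u ∂(Measure.dirac (1 : G)) = f 1 :=
  integral_dirac f 1

omit [MeasurableSpace G] [HaarData G] in
/-- kernel: freezing the block trees, bond by bond — `u[trees := 1](b) = 1` on a tree bond, `= u(b)` otherwise (r18's `axialBonds`
through its defining predicate `IsAxialBond`). [cite: BalabanImbrieJaffe1988, (5.1.4) p.278] -/
theorem fixBonds_axialBonds_apply {inst : DecidableEq (PBond P j)} (U : GaugeField P j G) (b : PBond P j) :
    fixBonds axialBonds U b = if IsAxialBond b then 1 else U b := by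
  by_cases hb : IsAxialBond b
  · rw [if_pos hb, fixBonds_apply_of_mem (mem_axialBonds.2 hb)]
  · rw [if_neg hb, fixBonds_apply_of_not_mem (mt mem_axialBonds.1 hb)]

/-- **(5.1.4) with the normalizations (5.1.3), as a measure**: `∫𝒟u δ_{Ax}(u)(·)` (r18's `axialMeasure`, the push-forward of `𝒟u`
under freezing the block trees) IS the product over the bonds of the point masses `δ(u_b)du_b` on the tree bonds `b ∈ ⋃_y T(y)` and
of the normalized Haar measures `du_b` on the other bonds — *"δ_{Ax}(u) = Π_{y∈T₁^{(k)′}} Π_{x∈B(y),x≠y} δ(u(Γ_{y,x}))"* read with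
*"∫duδ(u)f(u) = f(1), ∫du = 1"*. [cite: BalabanImbrieJaffe1988, (5.1.4) p.278] -/
theorem axialMeasure_eq_pi :
    axialMeasure P j G = Measure.pi (fun b : PBond P j =>
      if IsAxialBond b then Measure.dirac (1 : G) else (HaarData.haar : Measure G)) := by
  haveI : IsProbabilityMeasure (HaarData.haar : Measure G) := HaarData.isProb
  haveI : ∀ b : PBond P j, IsProbabilityMeasure
      (if IsAxialBond b then Measure.dirac (1 : G) else (HaarData.haar : Measure G)) := fun b => by
    by_cases hb : IsAxialBond b
    · rw [if_pos hb]; infer_instance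
    · rw [if_neg hb]; infer_instance
  have key := measurePreserving_pi (fun _ : PBond P j => (HaarData.haar : Measure G))
    (fun b : PBond P j => if IsAxialBond b then Measure.dirac (1 : G) else (HaarData.haar : Measure G))
    (f := fun (b : PBond P j) (g : G) => if IsAxialBond b then (1 : G) else g) (fun b => by
      by_cases hb : IsAxialBond b
      · simp only [if_pos hb]
        exact ⟨measurable_const, by rw [Measure.map_const, measure_univ, one_smul]⟩
      · simp only [if_neg hb]
        exact MeasurePreserving.id _)
  unfold axialMeasure fieldMeasure
  have e : (fixBonds axialBonds : GaugeField P j G → GaugeField P j G) =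
      fun (U : GaugeField P j G) (b : PBond P j) => if IsAxialBond b then (1 : G) else U b := by
    funext U b
    exact fixBonds_axialBonds_apply U b
  rw [e]
  exact key.map_eq

end Normalization

/-! ## §2 (5.1.4): gauge transformations trivial at the block-lattice points, and the free insertion of `δ_{Ax}` -/

section Pointed

variable {G : Type*} [GaugeGroup G]

/-- *"gauge transformations λ of u, φ, u^{(j)} that vanish on points of T_L^{(k+1)}"* (p. 278): a gauge transformation `g = e^{ie_kλ}`
of the unit lattice `T₁^{(k)}` is POINTED if it is trivial at every point of the block lattice, i.e. at every block corner `corner y`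
(`y ∈ T_L^{(k+1)}`; [2] (2.4)). [cite: BalabanImbrieJaffe1988, (5.1.4) p.278] -/
def IsPointed (g : GaugeTransf P j G) : Prop := ∀ y : Balaban1983to89.Site P (j+1), g (corner y) = 1

/-- Invariance of a function of the gauge field `u` under the pointed gauge transformations — the hypothesis of (5.1.4) on the
`u`-integrand (*"the δ-functions and ρ′_k are invariant … Q(u_k)φ invariant as well"*). [cite: BalabanImbrieJaffe1988, (5.1.4) p.278] -/
def PointedInvariant {α : Type*} (K : GaugeField P j G → α) : Prop :=
  ∀ g : GaugeTransf P j G, IsPointed g → ∀ U : GaugeField P j G, K (gaugeAct g U) = K U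

/-- kernel: the trivial gauge transformation is pointed. [cite: BalabanImbrieJaffe1988, (5.1.4) p.278] -/
theorem isPointed_one : IsPointed (fun _ : Balaban1983to89.Site P j => (1 : G)) := fun _ => rfl

/-- A gauge-invariant function is in particular pointed-invariant. [cite: BalabanImbrieJaffe1988, (5.1.4) p.278] -/
theorem pointedInvariant_of_gaugeInvariant {α : Type*} {K : GaugeField P j G → α} (hK : GaugeInvariant K) :
    PointedInvariant K := fun g _ U => hK g U

/-- kernel: the one-site gauge transformation at a site which is not a block corner is pointed. [cite: BalabanImbrieJaffe1988, (5.1.4) p.278] -/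
theorem isPointed_siteTransf {x : Balaban1983to89.Site P j} (hx : ∀ y : Balaban1983to89.Site P (j+1), x ≠ corner y) (g : G) :
    IsPointed (siteTransf x g) := fun y => by
  unfold siteTransf
  rw [if_neg (hx y).symm]

/-- kernel: a pointed-invariant function is invariant under the one-site transformations at the fresh ends `b₊` of all tree bonds —
the only invariance the tree gauge fixing uses; **the fresh ends are not block-lattice points** (r18's `BIJ88FreeCount48.tgt_ne_corner`:
the in-block position of `b₊` in the direction of `b` is positive, `inBlock_tgt`, the corner's is `0`, `inBlock_corner`).
[cite: BalabanImbrieJaffe1988, (5.1.4) p.278] -/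
theorem PointedInvariant.siteTransf_tgt (hj : j + 1 ≤ P.m + P.K) {α : Type*} {K : GaugeField P j G → α} (hK : PointedInvariant K) :
    ∀ b ∈ (axialBonds : Finset (PBond P j)), ∀ (g : G) (U : GaugeField P j G), K (gaugeAct (siteTransf b.tgt g) U) = K U :=
  fun _ hb g U => hK _ (isPointed_siteTransf (BIJ88FreeCount48.tgt_ne_corner hj (mem_axialBonds.1 hb)) g) U

variable [MeasurableSpace G] [HaarData G] [MeasurableMul G]

/-- **Tree gauge fixing, law form, under fresh-end invariance only**: for a bond set `T` carrying a `TreeOrder` and a measurable `F`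
(values in any measurable space) invariant under the one-site gauge transformations at the fresh ends `v b`, `b ∈ T`, `F` and
`F ∘ (·)[T := 1]` have the same law under `𝒟u` (the cell's `T4AxialGaugeFixing.map_eq_map_fixBonds` asks full gauge invariance; its
engine `lintegral_eq_lintegral_fixBonds_of_treeOrder` only this). [cite: BalabanImbrieJaffe1988, (5.1.4) p.278] -/
theorem map_eq_map_fixBonds_of_treeOrder {inst : DecidableEq (PBond P j)} {T : Finset (PBond P j)}
    {v : PBond P j → Balaban1983to89.Site P j} {r : Balaban1983to89.Site P j → ℕ} (hT : TreeOrder T v r)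
    {α : Type*} [MeasurableSpace α] {F : GaugeField P j G → α} (hF : Measurable F)
    (hinv : ∀ b ∈ T, ∀ (g : G) (U : GaugeField P j G), F (gaugeAct (siteTransf (v b) g) U) = F U) :
    (fieldMeasure P j G).map F = (fieldMeasure P j G).map (fun U => F (fixBonds T U)) := by
  have hF' : Measurable fun U => F (fixBonds T U) := hF.comp (measurable_fixBonds T)
  ext A hA
  rw [Measure.map_apply hF hA, Measure.map_apply hF' hA, ← lintegral_indicator_one (hF hA),
    ← lintegral_indicator_one (hF' hA)]
  have hind : Measurable fun U => (A.indicator (1 : α → ℝ≥0∞)) (F U) := (measurable_one.indicator hA).comp hF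
  have key := lintegral_eq_lintegral_fixBonds_of_treeOrder hT hind
    (fun b hb g U => by simp only [hinv b hb g U])
  have e1 : ∀ U, (F ⁻¹' A).indicator (1 : GaugeField P j G → ℝ≥0∞) U = A.indicator 1 (F U) := fun U => by
    simpa only [Pi.one_comp] using Set.indicator_comp_right F (s := A) (g := (1 : α → ℝ≥0∞)) (x := U)
  have e2 : ∀ U, ((fun U => F (fixBonds T U)) ⁻¹' A).indicator (1 : GaugeField P j G → ℝ≥0∞) U =
      A.indicator 1 (F (fixBonds T U)) := fun U => by
    simpa only [Pi.one_comp] using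
      Set.indicator_comp_right (fun U => F (fixBonds T U)) (s := A) (g := (1 : α → ℝ≥0∞)) (x := U)
  calc ∫⁻ U, (F ⁻¹' A).indicator 1 U ∂fieldMeasure P j G
      = ∫⁻ U, A.indicator 1 (F U) ∂fieldMeasure P j G := lintegral_congr e1
    _ = ∫⁻ U, A.indicator 1 (F (fixBonds T U)) ∂fieldMeasure P j G := key
    _ = ∫⁻ U, ((fun U => F (fixBonds T U)) ⁻¹' A).indicator 1 U ∂fieldMeasure P j G := (lintegral_congr e2).symm

/-- **(5.1.4), law form**: for every measurable, POINTED-invariant `K` (values in any measurable space) the law of `K` under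
`∫𝒟u δ_{Ax}(u)(·)` is its law under `𝒟u` (standing range). [cite: BalabanImbrieJaffe1988, (5.1.4) p.278] -/
theorem map_axialMeasure_eq_of_pointed (hj : j + 1 ≤ P.m + P.K) {α : Type*} [MeasurableSpace α] {K : GaugeField P j G → α}
    (hK : Measurable K) (hinv : PointedInvariant K) :
    (axialMeasure P j G).map K = (fieldMeasure P j G).map K := by
  unfold axialMeasure
  rw [Measure.map_map hK (measurable_fixBonds _)]
  exact (map_eq_map_fixBonds_of_treeOrder (treeOrder_axialBonds hj) hK (hinv.siteTransf_tgt hj)).symm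

/-- **(5.1.4)** p. 278 [PDF 22], verbatim: *"Under gauge transformations λ of u, φ, u^{(j)} that vanish on points of T_L^{(k+1)}, we see
that the δ-functions and ρ′_k are invariant. Since u_k also transforms by λ, we have Q(u_k)φ invariant as well. Thus no change is made
if we insert the axial gauge conditions δ_{Ax}(u) = Π_{y∈T₁^{(k)′}} Π_{x∈B(y),x≠y} δ(u(Γ_{y,x})) (5.1.4) into the u-integral above."* —
PROVED as the Faddeev–Popov identity with unit Jacobian for the block trees under POINTED invariance only: `∫𝒟u δ_{Ax}(u) K(u) =
∫𝒟u K(u)` for every measurable `u`-integrand `K` (values in any Banach space) invariant under the gauge transformations trivial at the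
block-lattice points (any gauge group; standing range).  Mechanism: the block trees are peeled from their fresh ends `b₊`
(`treeOrder_axialBonds`), which are never block corners (`BIJ88FreeCount48.tgt_ne_corner`), one Haar translation at a time.
[cite: BalabanImbrieJaffe1988, (5.1.4) p.278] -/
theorem integral_axialMeasure_eq_of_pointed (hj : j + 1 ≤ P.m + P.K) {E : Type*} [NormedAddCommGroup E] [NormedSpace ℝ E]
    [MeasurableSpace E] [BorelSpace E] [SecondCountableTopology E] {K : GaugeField P j G → E} (hK : Measurable K)
    (hinv : PointedInvariant K) :
    ∫ U, K U ∂axialMeasure P j G = ∫ U, K U ∂fieldMeasure P j G := by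
  have h1 : ∫ U, K U ∂axialMeasure P j G = ∫ z, z ∂(axialMeasure P j G).map K :=
    (integral_map hK.aemeasurable aestronglyMeasurable_id).symm
  have h2 : ∫ U, K U ∂fieldMeasure P j G = ∫ z, z ∂(fieldMeasure P j G).map K :=
    (integral_map hK.aemeasurable aestronglyMeasurable_id).symm
  rw [h1, h2, map_axialMeasure_eq_of_pointed hj hK hinv]

end Pointed

/-! ## §3 (5.1.1): the renormalization transformation of the general step, TYPED; its normalization -/

section GeneralStep

variable {k : ℕ}

/-- READING NOTE on **(5.1.2)**: the constant of r18's normalized `ψ`-Gaussian `gaussWeight a` at level `k` is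
`|T_L^{(k+1)}|·E^{(k)}` with `E^{(k)} = −log(aL^{d−2}/2π)` the printed per-site constant (r16's `BIJ88Sect5Statements.normE`,
`E0step_eq_card_mul_normE`; `d ≥ 2`). [cite: BalabanImbrieJaffe1988, (5.1.2) p.277] -/
theorem E0step_level_eq_normE (hd : 2 ≤ P.d) (a : ℝ) :
    E0step (Fintype.card (Balaban1983to89.Site P (k+1))) a P.L P.d =
      Fintype.card (Balaban1983to89.Site P (k+1)) * BIJ88Sect5Statements.normE a P.L P.d :=
  BIJ88Sect5Statements.E0step_eq_card_mul_normE _ a P.L hd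

/-- **(5.1.1)** p. 277 [PDF 21] (verbatim in the module docstring) — the renormalization transformation OF THE GENERAL STEP, TYPED in
the push-forward reading of the `δ`-functions (the tree's convention for `δ(v/Qu)`, as r18's `IsRT311` for (3.11)): `ρ̃ = ρ̃^L_{k+1}`
is a `(v, ψ)`-density (w.r.t. `dv dψ` on the block lattice, level `k + 1`) such that for every bounded measurable test function `g`,
`∫dv∫dψ ρ̃(v, ψ) g(v, ψ) = Σ_{t ∈ terms} ∫𝒟u ∫Π_{j<k}𝒟u^{(j)} ∫𝒟φ ∫dψ ρ′_t({u^{(j)}}, u, φ) · exp[−½aL⁻²⟨ψ − Q_tφ, ψ − Q_tφ⟩ − |T_L|E^{(k)}] · g(Qu, ψ)`.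
DATA: `terms` = the finite family of large-field configurations `{X_ω}` summed over, `ρ′ t` = `ρ′_k(u, φ, {X_ω}, {u^{(j)}})` as a
function of `({u^{(j)}}, u, φ)` (for the (4.1) terms: r18's `BIJ88InductiveForm41.rhoPrime`), `Qu` = the gauge-field block average
([2] (2.10)), `Qφ t` = the BACKGROUND-FIELD scalar average `({u^{(j)}}, u, φ) ↦ Q(u_k)φ` (`u_k` of (4.2) depends on `u` and the
`u^{(j)}`), `a` = the Gaussian parameter (*"a ≈ 1 is fixed throughout"*); the `u^{(j)}` are integrated against the normalized
`Π𝒟u^{(j)}` (`prevMeasure`) between `𝒟u` and `𝒟φ`, as printed.  No `δ_{Ax}` — see `IsRT511Ax` and (5.1.4).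
[cite: BalabanImbrieJaffe1988, (5.1.1) p.277] -/
def IsRT511 {ι : Type*} (terms : Finset ι) (Qu : GaugeField P k U1 → GaugeField P (k+1) U1)
    (Qφ : ι → Prev P k → GaugeField P k U1 → HiggsField P k → HiggsField P (k+1)) (a : ℝ)
    (ρ' : ι → Prev P k → GaugeField P k U1 → HiggsField P k → ℂ)
    (ρL : GaugeField P (k+1) U1 → HiggsField P (k+1) → ℂ) : Prop :=
  ∀ g : GaugeField P (k+1) U1 × HiggsField P (k+1) → ℂ, Measurable g → (∃ C : ℝ, ∀ z, ‖g z‖ ≤ C) →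
    ∫ v, ∫ ψ, ρL v ψ * g (v, ψ) ∂volume ∂fieldMeasure P (k+1) U1 =
      ∑ t ∈ terms, ∫ U, ∫ prev, ∫ φ, ∫ ψ, ρ' t prev U φ * (gaussWeight a (Qφ t prev U φ) ψ : ℂ) * g (Qu U, ψ)
        ∂volume ∂volume ∂prevMeasure P k ∂fieldMeasure P k U1

/-- **(5.1.1) with (5.1.4) inserted**: the same transformation with the axial gauge conditions `δ_{Ax}(u)` in the `u`-integral
(`∫𝒟u δ_{Ax}(u)(·)` = r18's `axialMeasure`) — the form in which the first step (3.11) is printed. [cite: BalabanImbrieJaffe1988, (5.1.4) p.278] -/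
def IsRT511Ax {ι : Type*} (terms : Finset ι) (Qu : GaugeField P k U1 → GaugeField P (k+1) U1)
    (Qφ : ι → Prev P k → GaugeField P k U1 → HiggsField P k → HiggsField P (k+1)) (a : ℝ)
    (ρ' : ι → Prev P k → GaugeField P k U1 → HiggsField P k → ℂ)
    (ρL : GaugeField P (k+1) U1 → HiggsField P (k+1) → ℂ) : Prop :=
  ∀ g : GaugeField P (k+1) U1 × HiggsField P (k+1) → ℂ, Measurable g → (∃ C : ℝ, ∀ z, ‖g z‖ ≤ C) →
    ∫ v, ∫ ψ, ρL v ψ * g (v, ψ) ∂volume ∂fieldMeasure P (k+1) U1 =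
      ∑ t ∈ terms, ∫ U, ∫ prev, ∫ φ, ∫ ψ, ρ' t prev U φ * (gaussWeight a (Qφ t prev U φ) ψ : ℂ) * g (Qu U, ψ)
        ∂volume ∂volume ∂prevMeasure P k ∂axialMeasure P k U1

/-- The `u`-INTEGRAND of one term of (5.1.1) tested against `g`:
`u ↦ ∫Π𝒟u^{(j)} ∫𝒟φ ∫dψ ρ′({u^{(j)}}, u, φ) exp[−½aL⁻²⟨ψ − Q(u_k)φ, ψ − Q(u_k)φ⟩ − |T_L|E^{(k)}] g(Qu, ψ)` — *"the u-integral above"* of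
(5.1.4) integrates this function against `𝒟u`, resp. `𝒟u δ_{Ax}(u)`. [cite: BalabanImbrieJaffe1988, (5.1.1) p.277] -/
def uIntegrand (Qu : GaugeField P k U1 → GaugeField P (k+1) U1)
    (Qφ : Prev P k → GaugeField P k U1 → HiggsField P k → HiggsField P (k+1)) (a : ℝ)
    (ρ' : Prev P k → GaugeField P k U1 → HiggsField P k → ℂ) (g : GaugeField P (k+1) U1 × HiggsField P (k+1) → ℂ)
    (U : GaugeField P k U1) : ℂ :=
  ∫ prev, ∫ φ, ∫ ψ, ρ' prev U φ * (gaussWeight a (Qφ prev U φ) ψ : ℂ) * g (Qu U, ψ) ∂volume ∂volume ∂prevMeasure P k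

/-- unfolding: (5.1.1) says `∫dv∫dψ ρ̃ g = Σ_t ∫𝒟u (uIntegrand of t)`. [cite: BalabanImbrieJaffe1988, (5.1.1) p.277] -/
theorem isRT511_iff {ι : Type*} (terms : Finset ι) (Qu : GaugeField P k U1 → GaugeField P (k+1) U1)
    (Qφ : ι → Prev P k → GaugeField P k U1 → HiggsField P k → HiggsField P (k+1)) (a : ℝ)
    (ρ' : ι → Prev P k → GaugeField P k U1 → HiggsField P k → ℂ) (ρL : GaugeField P (k+1) U1 → HiggsField P (k+1) → ℂ) :
    IsRT511 terms Qu Qφ a ρ' ρL ↔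
      ∀ g : GaugeField P (k+1) U1 × HiggsField P (k+1) → ℂ, Measurable g → (∃ C : ℝ, ∀ z, ‖g z‖ ≤ C) →
        ∫ v, ∫ ψ, ρL v ψ * g (v, ψ) ∂volume ∂fieldMeasure P (k+1) U1 =
          ∑ t ∈ terms, ∫ U, uIntegrand Qu (Qφ t) a (ρ' t) g U ∂fieldMeasure P k U1 :=
  Iff.rfl

/-- unfolding: (5.1.1)-with-(5.1.4) says `∫dv∫dψ ρ̃ g = Σ_t ∫𝒟u δ_{Ax}(u) (uIntegrand of t)`. [cite: BalabanImbrieJaffe1988, (5.1.4) p.278] -/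
theorem isRT511Ax_iff {ι : Type*} (terms : Finset ι) (Qu : GaugeField P k U1 → GaugeField P (k+1) U1)
    (Qφ : ι → Prev P k → GaugeField P k U1 → HiggsField P k → HiggsField P (k+1)) (a : ℝ)
    (ρ' : ι → Prev P k → GaugeField P k U1 → HiggsField P k → ℂ) (ρL : GaugeField P (k+1) U1 → HiggsField P (k+1) → ℂ) :
    IsRT511Ax terms Qu Qφ a ρ' ρL ↔
      ∀ g : GaugeField P (k+1) U1 × HiggsField P (k+1) → ℂ, Measurable g → (∃ C : ℝ, ∀ z, ‖g z‖ ≤ C) →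
        ∫ v, ∫ ψ, ρL v ψ * g (v, ψ) ∂volume ∂fieldMeasure P (k+1) U1 =
          ∑ t ∈ terms, ∫ U, uIntegrand Qu (Qφ t) a (ρ' t) g U ∂axialMeasure P k U1 :=
  Iff.rfl

/-- **ONE TERM WHOSE DATA IGNORE THE EARLIER FIELDS IS (3.11)**: for a single term (`terms = {t}` over `Unit`) with `ρ′` and the scalar
average independent of `{u^{(j)}}`, (5.1.1)-with-(5.1.4) at level `k` is literally r18's typed (3.11) `IsRT311` (the `Π𝒟u^{(j)}`-integral
of a constant is the constant) — the first step is the general step with no history. [cite: BalabanImbrieJaffe1988, (5.1.1) p.277] -/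
theorem isRT511Ax_single_iff_isRT311 (Qu : GaugeField P k U1 → GaugeField P (k+1) U1)
    (Qφ₀ : GaugeField P k U1 → HiggsField P k → HiggsField P (k+1)) (a : ℝ) (ρ₀ : GaugeField P k U1 → HiggsField P k → ℂ)
    (ρL : GaugeField P (k+1) U1 → HiggsField P (k+1) → ℂ) :
    IsRT511Ax (Finset.univ : Finset Unit) Qu (fun _ _ => Qφ₀) a (fun _ _ => ρ₀) ρL ↔ IsRT311 Qu Qφ₀ a ρ₀ ρL := by
  unfold IsRT511Ax IsRT311
  simp only [Finset.univ_unique, Finset.sum_singleton, BIJ88InductiveForm41.integral_rhoPrime_const]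

/-- **THE NORMALIZATION OF (5.1.1)** — the general-step analogue of (3.13)/(3.7): for EVERY `ρ̃` satisfying the printed (`δ_{Ax}`-free)
(5.1.1), `∫dv dψ ρ̃(v, ψ) = Σ_{t∈terms} ∫𝒟u ∫Π𝒟u^{(j)} ∫𝒟φ ρ′_t({u^{(j)}}, u, φ)` (`a > 0`, `d ≥ 2`; ANY data `Qu`, `Q_t`, `ρ′_t`): test
`g ≡ 1`, the `ψ`-Gaussian integrates to `1` by (5.1.2)/(3.12) (`integral_gaussWeight`), `δ(v/Qu)` integrates to `1`.  No gauge
invariance is needed as long as no gauge condition is inserted. [cite: BalabanImbrieJaffe1988, (5.1.1) p.277] -/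
theorem integral_eq_of_isRT511 {ι : Type*} (hd : 2 ≤ P.d) {a : ℝ} (ha : 0 < a) {terms : Finset ι}
    {Qu : GaugeField P k U1 → GaugeField P (k+1) U1} {Qφ : ι → Prev P k → GaugeField P k U1 → HiggsField P k → HiggsField P (k+1)}
    {ρ' : ι → Prev P k → GaugeField P k U1 → HiggsField P k → ℂ} {ρL : GaugeField P (k+1) U1 → HiggsField P (k+1) → ℂ}
    (h : IsRT511 terms Qu Qφ a ρ' ρL) :
    ∫ v, ∫ ψ, ρL v ψ ∂volume ∂fieldMeasure P (k+1) U1 =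
      ∑ t ∈ terms, ∫ U, ∫ prev, ∫ φ, ρ' t prev U φ ∂volume ∂prevMeasure P k ∂fieldMeasure P k U1 := by
  have h1 := h (fun _ => (1 : ℂ)) measurable_const ⟨1, fun _ => by simp⟩
  simp only [mul_one] at h1
  rw [h1]
  refine Finset.sum_congr rfl fun t _ => ?_
  have hin : ∀ (prev : Prev P k) (U : GaugeField P k U1) (φ : HiggsField P k),
      ∫ ψ, ρ' t prev U φ * (gaussWeight a (Qφ t prev U φ) ψ : ℂ) = ρ' t prev U φ := fun prev U φ => by
    rw [integral_const_mul, integral_complex_ofReal, integral_gaussWeight ha hd, Complex.ofReal_one, mul_one]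
  simp_rw [hin]

/-- The same for (5.1.1) WITH the axial gauge conditions, when the `(u^{(j)}, φ)`-integrated densities `u ↦ ∫Π𝒟u^{(j)}∫𝒟φ ρ′_t` are
measurable and pointed-invariant: `δ_{Ax}` then drops by (5.1.4) (`integral_axialMeasure_eq_of_pointed`).
[cite: BalabanImbrieJaffe1988, (5.1.4) p.278] -/
theorem integral_eq_of_isRT511Ax {ι : Type*} (hk : k + 1 ≤ P.m + P.K) (hd : 2 ≤ P.d) {a : ℝ} (ha : 0 < a) {terms : Finset ι}
    {Qu : GaugeField P k U1 → GaugeField P (k+1) U1} {Qφ : ι → Prev P k → GaugeField P k U1 → HiggsField P k → HiggsField P (k+1)}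
    {ρ' : ι → Prev P k → GaugeField P k U1 → HiggsField P k → ℂ} {ρL : GaugeField P (k+1) U1 → HiggsField P (k+1) → ℂ}
    (h : IsRT511Ax terms Qu Qφ a ρ' ρL)
    (hm : ∀ t ∈ terms, Measurable fun U : GaugeField P k U1 => ∫ prev, ∫ φ, ρ' t prev U φ ∂volume ∂prevMeasure P k)
    (hinv : ∀ t ∈ terms, PointedInvariant fun U : GaugeField P k U1 => ∫ prev, ∫ φ, ρ' t prev U φ ∂volume ∂prevMeasure P k) :
    ∫ v, ∫ ψ, ρL v ψ ∂volume ∂fieldMeasure P (k+1) U1 =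
      ∑ t ∈ terms, ∫ U, ∫ prev, ∫ φ, ρ' t prev U φ ∂volume ∂prevMeasure P k ∂fieldMeasure P k U1 := by
  have h1 := h (fun _ => (1 : ℂ)) measurable_const ⟨1, fun _ => by simp⟩
  simp only [mul_one] at h1
  rw [h1]
  refine Finset.sum_congr rfl fun t ht => ?_
  have hin : ∀ (prev : Prev P k) (U : GaugeField P k U1) (φ : HiggsField P k),
      ∫ ψ, ρ' t prev U φ * (gaussWeight a (Qφ t prev U φ) ψ : ℂ) = ρ' t prev U φ := fun prev U φ => by
    rw [integral_const_mul, integral_complex_ofReal, integral_gaussWeight ha hd, Complex.ofReal_one, mul_one]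
  simp_rw [hin]
  exact integral_axialMeasure_eq_of_pointed hk (hm t ht) (hinv t ht)

end GeneralStep

end

end Literature.MathematicalPhysics.QuantumFieldTheory.BalabanImbrieJaffe1984to88.BIJ88RT51GeneralStep
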